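/-
Copyright (c) 2026. All rights reserved.
Released under Apache 2.0 license as described in the file LICENSE.
Authors: abc-iut cell, statement-typer seat abc-iut-L4-t3 (wave 1; gen 6), over the model settings of abc-iut-w4-d095.
-/
import Literature.AnabelianGeometry.AbsoluteAnabelian.LogFrobeniusLogWallNonarchModel
import Literature.AnabelianGeometry.AbsoluteAnabelian.LogFrobeniusCoresProofs
import HarnessLib

/-!
# [AbsTopIII] Corollary 5.5 (i) at the two settings with GENUINE components (FACT-LIST F-0140 `Cor55Cores`: the instances of the L-F programme)

S. Mochizuki, *Topics in absolute anabelian geometry III: global reconstruction algorithms*,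
J. Math. Sci. Univ. Tokyo 22 (2015) 939–1156 [MochizukiAbsTopIII2015]; locators `p.N` = pages of the author's
manuscript (`paper:url-5493eb38cbb7`), read on the page (own render p0130 l.40–44): Cor 5.5 (i) p. 130 ("(Cores) For
`n = 5, 6, 7`, `D•_{≤n}` admits a natural structure of core on `D•_{≤n-1}`. That is to say, loosely speaking, `ℰ•`,
`An•[𝒳]` 'form cores' of the functors in `D•`"), Def 3.5 (iii) pp. 75–76 (cores), Def 5.4 (iv)/(v) p. 127, Cor 5.2 (iv)
p. 119 (`An•[𝒳]`).

PROOF-ONLY (no `def`; nothing restated).  The cell's L-F programme (HOME/plan/L4/LF-ABSTOP.tsv row F-0140, L4-lead GO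
m28 2026-08-26T14:31:52Z) asks for the instances of this seat's typed row `LogFrobeniusSetting.Cor55Cores`
(`LogFrobeniusCorollaries.lean`, FACT-LIST F-0140; universal closure REFUTED at `V(F_mod) = ∅`, PROVED at every setting
with `V(F_mod) ≠ ∅`: abc-iut-L4-t15's `cor55Cores_holds`, `cor55Cores_iff_nonempty`) at the two §5 settings of the tree
carrying GENUINE components, both by abc-iut-w4-d095:

* `LogFrobeniusSetting.archGenuine 𝔄 Vmod isArc` (`LogFrobeniusLogWallArchOrigin.lean`): `𝒳 := 𝒞^hol_TF`, GENUINE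
  `ℰ• := EA` and `An•[𝒳] := LinHol` with `κ_LH`, `φ_LH`, `η_LH` (abc-iut-L4-t2's archimedean model), archimedean
  `λ⊞`/`ι⊞` = the printed graph of Def 5.4 (v); placeholders: the nonarchimedean components, the second equivalence
  `An• ≃ ℰ•`, the mono-analytic side.  HERE the row-5/6 vertices `ℰ•`, `An•[𝒳]` that Cor 5.5 (i) says "form cores" ARE
  genuine model categories, so `archGenuine_cor55Cores` is an instance at genuine data for `n = 5, 6` (the `n = 7` clause
  concerns the placeholder `κ_LH⁻¹`);
* `LogFrobeniusSetting.nonarchGenuine p Vmod isArc` (`LogFrobeniusLogWallNonarchModel.lean`): GENUINE nonarchimedean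
  `𝒩⊞_v = 𝒩_v`, `λ⊞_{v,ν}`, `ι⊞_{v,ε}` over abc-iut-L4-t9's MLF model; PLACEHOLDERS `ℰ• := 𝒳`, `An•[𝒳] := 𝒳` (identity
  equivalences) — so at this carrier the instance is exactly as informative as the universal theorem (honest label).

For each: the instance for nonempty `V(F_mod)` (one line over `cor55Cores_holds`), the EXACT criterion `↔ Nonempty Vmod`
(`cor55Cores_iff_nonempty`), and the binder-free corollary from a named place `v₀`.  Refereed pre-IUT material; OUR kernel
checks; nothing here bears on [IUTchIII] Cor. 3.12; no side taken; instance at a model ≠ the printed theorem for the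
printed theaters; typed ≠ proved.
-/

set_option autoImplicit false

noncomputable section

universe u

open CategoryTheory

namespace Literature.AnabelianGeometry.AbsoluteAnabelian

namespace LogFrobeniusSetting

/-! ## Cor 5.5 (i) at the setting with genuine ARCHIMEDEAN components (`ℰ• = EA`, `An• = LinHol` genuine) -/

section Arch

variable (𝔄 : AutHolFieldFunctor.{u}) (Vmod : Type (u + 1)) (isArc : Vmod → Bool)

/-- **F-0140 at `archGenuine`**: for every index set with an element, `ℰ• = EA`, `An•[𝒳] = LinHol 𝔄`, `ℰ•` form cores of
`D•_{≤4}`, `D•_{≤5}`, `D•_{≤6}` at abc-iut-w4-d095's setting with genuine archimedean components (abc-iut-L4-t15's universal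
`cor55Cores_holds` at genuine row-5/6 categories). [cite: MochizukiAbsTopIII2015, Cor 5.5 (i) p.130] -/
theorem archGenuine_cor55Cores [Nonempty Vmod] : (archGenuine 𝔄 Vmod isArc).Cor55Cores :=
  (archGenuine 𝔄 Vmod isArc).cor55Cores_holds

/-- At `archGenuine`, `Cor55Cores` holds EXACTLY when `V(F_mod)` is nonempty (`𝒳_⋎` reaches `ℰ•` only through some
`𝒩⊞_v`). [cite: MochizukiAbsTopIII2015, Cor 5.5 (i) p.130] -/
theorem archGenuine_cor55Cores_iff : (archGenuine 𝔄 Vmod isArc).Cor55Cores ↔ Nonempty Vmod :=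
  (archGenuine 𝔄 Vmod isArc).cor55Cores_iff_nonempty

/-- Binder-free form: over an index set with a named place `v₀` (archimedean or not), Cor 5.5 (i) holds at
`archGenuine`. [cite: MochizukiAbsTopIII2015, Cor 5.5 (i) p.130] -/
theorem archGenuine_cor55Cores_of_mem (v₀ : Vmod) : (archGenuine 𝔄 Vmod isArc).Cor55Cores :=
  haveI : Nonempty Vmod := ⟨v₀⟩
  archGenuine_cor55Cores 𝔄 Vmod isArc

end Arch

/-! ## Cor 5.5 (i) at the setting with genuine NONARCHIMEDEAN components (`ℰ•`, `An•` placeholders) -/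

section Nonarch

variable (p : ℕ) [Fact p.Prime] (Vmod : Type 1) (isArc : Vmod → Bool)

/-- **F-0140 at `nonarchGenuine`**: for every index set with an element, Cor 5.5 (i) as typed holds at abc-iut-w4-d095's
setting with genuine nonarchimedean components — honest label: its `ℰ• := 𝒳`, `An•[𝒳] := 𝒳` are PLACEHOLDERS (identity
equivalences), so this instance carries no more than the universal `cor55Cores_holds`. [cite: MochizukiAbsTopIII2015, Cor 5.5 (i) p.130] -/
theorem nonarchGenuine_cor55Cores [Nonempty Vmod] : (nonarchGenuine p Vmod isArc).Cor55Cores :=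
  (nonarchGenuine p Vmod isArc).cor55Cores_holds

/-- At `nonarchGenuine`, `Cor55Cores` holds EXACTLY when `V(F_mod)` is nonempty.
[cite: MochizukiAbsTopIII2015, Cor 5.5 (i) p.130] -/
theorem nonarchGenuine_cor55Cores_iff : (nonarchGenuine p Vmod isArc).Cor55Cores ↔ Nonempty Vmod :=
  (nonarchGenuine p Vmod isArc).cor55Cores_iff_nonempty

/-- Binder-free form: over an index set with a named place `v₀`, Cor 5.5 (i) holds at `nonarchGenuine`.
[cite: MochizukiAbsTopIII2015, Cor 5.5 (i) p.130] -/
theorem nonarchGenuine_cor55Cores_of_mem (v₀ : Vmod) : (nonarchGenuine p Vmod isArc).Cor55Cores :=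
  haveI : Nonempty Vmod := ⟨v₀⟩
  nonarchGenuine_cor55Cores p Vmod isArc

end Nonarch

end LogFrobeniusSetting

end Literature.AnabelianGeometry.AbsoluteAnabelian
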